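import Summits.AnomalousDissipation.AnomalousDissipation.Theorems.EnsembleRigidityGPStatisticalRigidityLinearHorizon
import Summits.AnomalousDissipation.AnomalousDissipation.Theorems.EnsembleRigidityGPStatisticalRigidityWeakDuality2
import HarnessLib

/-!
# Stub `stub_linearFloor` of line `Sketch` (crux stmt-AnomalousDissipation-17938, `EnsembleRigidity.GPTameDefectFloor`) — the linear layer of the tame defect floor

THE LINEAR LAYER. Let `f = f_GP` be the Galloway–Proctor force (`gpForce`) and `w ∈ 𝒱` a smooth
solenoidal mean-zero test field whose Reynolds-stress form is bounded below by energy and enstrophy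
on the finite-enstrophy part of the energy space `H`,

  `−(s_E |v|² + s_G ‖∇v‖²) ≤ ∫ ⟪∇w(x) v(x), v(x)⟫ dx = ∫ (v ⊗ v) : ∇w`   (`s_E, s_G ≥ 0`).

Then at every energy/enstrophy level `(E, G₁)` with `s_E E + s_G max(G₁, 0) < (f, w)` there is a
radius `r > 0` such that no probability measure `μ` on `H` with `∫ |v|² dμ ≤ E`, `∫ ‖∇v‖² dμ ≤ G₁`
has Φ-uniform cylindrical forced-Euler defect `≤ r`.

## Proof

Put `P := (f, w)`, `M := max(G₁, 0)`, `gap := P − s_E E − s_G M > 0`, `Q := ‖∇w‖₂` and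
`r := gap / (2 (Q + 1))`. For such a `μ`:

1. removing the cut-off (`GPStatisticalRigidity.stub_linearTestLimit`), the Φ-uniform defect bound
   gives the fixed-test balance `|∫ ⟨f − B(v,v), w⟩ dμ| ≤ r Q`;
2. the mean enstrophy is finite (`≤ G₁`), so the form bound holds `μ`-a.e. and integrates
   (`linFloor_integral_nsGeneratorPairing_ge`) to
   `∫ ⟨f − B(v,v), w⟩ dμ = P + ∫∫ (v ⊗ v) : ∇w ≥ P − s_E ∫|v|² dμ − s_G ∫‖∇v‖² dμ`;
3. monotonicity (`s_E, s_G ≥ 0`, `∫|v|² ≤ E`, `∫‖∇v‖² ≤ M`) gives `gap ≤ r Q = gap · Q/(2(Q+1)) < gap`,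
   a contradiction.

This is the level-wise form (with an enstrophy term) of the linear horizon
`GPStatisticalRigidity.stub_gpLinearHorizon` of the sibling crux.

## References

* C. Foias, O. Manley, R. Rosa, R. Temam, *Navier–Stokes Equations and Turbulence* (CUP 2001),
  Ch. IV §1.2 Def. 1.3, (1.29)–(1.31) (stationary statistical solutions, the tested generator).
* R. Rosa, R. Temam, arXiv:2010.06730 (auxiliary functionals for statistical solutions).
-/

-- `Summit.<Summit>.<Problem>` is the tree's mandated summit-side namespace (CONVENTIONS §2); single-conjunct summit, duplicate deliberate.
set_option linter.dupNamespace false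

noncomputable section

namespace Summit.AnomalousDissipation.AnomalousDissipation.Theorems.EnsembleRigidity.GPTameDefectFloor

open MeasureTheory Filter Topology UnitAddTorus
open scoped InnerProductSpace RealInnerProductSpace ENNReal NNReal
open Literature.Analysis.FunctionSpaces Literature.Analysis.FluidPDE
open Summit.AnomalousDissipation.AnomalousDissipation.Theorems.EnsembleRigidity

/-- Local notation: real vector fields on `T³`. -/
local notation "Vec3" => (UnitAddTorus (Fin 3)) → (EuclideanSpace ℝ (Fin 3))
/-- Local notation: `L²(T³; ℝ³)`. -/
local notation "L2" => (Lp (EuclideanSpace ℝ (Fin 3)) 2 (volume : Measure (UnitAddTorus (Fin 3))))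
/-- Local notation: the energy space `H`. -/
local notation "H3" => (Torus.energySpace (Fin 3))

/-! ## Integrating the form bound -/

-- adapted from `GPStatisticalRigidity.linearHorizon_integral_nsGeneratorPairing_ge` (…LinearHorizon.lean):
-- the pointwise strain bound is replaced by the form bound on `H` with an enstrophy term, handled
-- as in `GPStatisticalRigidity.weakDuality2_integrate` (…WeakDuality2.lean).
/-- **The `μ`-averaged second-moment test with an enstrophy term.** For a smooth `w` with the form
bound `−(s_E |v|² + s_G ‖∇v‖²) ≤ ∫ (v ⊗ v) : ∇w` on finite-enstrophy fields of `H`, any force `f` and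
a probability measure `μ` on `H` with `∫ |v|² dμ < ∞` and finite mean enstrophy:
`∫ ⟨f − B(v,v), w⟩ dμ ≥ (f, w) − s_E ∫ |v|² dμ − s_G ∫ ‖∇v‖² dμ`. [folklore] -/
theorem linFloor_integral_nsGeneratorPairing_ge (f : Vec3) {w : Vec3} (hw : Torus.IsSmooth w)
    {sE sG : ℝ}
    (hform : ∀ v : H3, Torus.eGradNormSq ((v : L2) : Vec3) ≠ ⊤ →
      -(sE * ‖v‖ ^ 2 + sG * (Torus.eGradNormSq ((v : L2) : Vec3)).toReal) ≤
        Torus.inertialPairing (v : L2) w)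
    (μ : Measure H3) [IsProbabilityMeasure μ] (hint : Integrable (fun v : H3 => ‖v‖ ^ 2) μ)
    (hGfin : Torus.ensembleEnstrophy μ < ⊤) :
    (∫ x, ⟪f x, w x⟫_ℝ) - sE * Torus.ensembleEnergy μ - sG * (Torus.ensembleEnstrophy μ).toReal ≤
      ∫ v, Torus.nsGeneratorPairing 0 f v w ∂μ := by
  -- the tested generator, pointwise in `v`
  have hgen : ∀ v : H3, Torus.nsGeneratorPairing 0 f v w =
      (∫ x, ⟪f x, w x⟫_ℝ) + Torus.inertialPairing (v : L2) w := by
    intro v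
    rw [Torus.nsGeneratorPairing, zero_mul, add_zero]
  -- (1) the enstrophy density: measurable, finite a.e., integrable, of integral `G`
  have hGm : Measurable fun u : H3 => Torus.eGradNormSq ((u : L2) : Vec3) :=
    Torus.measurable_eGradNormSq_coe
  have hGlt : ∀ᵐ u : H3 ∂μ, Torus.eGradNormSq ((u : L2) : Vec3) < ⊤ := ae_lt_top hGm hGfin.ne
  have haI : Integrable (fun u : H3 => (Torus.eGradNormSq ((u : L2) : Vec3)).toReal) μ :=
    integrable_toReal_of_lintegral_ne_top hGm.aemeasurable hGfin.ne
  have hGa : ∫ u : H3, (Torus.eGradNormSq ((u : L2) : Vec3)).toReal ∂μ =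
      (Torus.ensembleEnstrophy μ).toReal := by
    rw [Torus.ensembleEnstrophy, integral_toReal hGm.aemeasurable hGlt]
  -- (2) integrability of `v ↦ ∫ (v ⊗ v) : ∇w` (continuous, quadratically bounded)
  obtain ⟨C, _, hC⟩ := GPStatisticalRigidity.linearHorizon_abs_inertialPairing_le hw
  have hcont : Continuous fun v : H3 => Torus.inertialPairing (v : L2) w :=
    Torus.continuous_inertialPairing_coe hw
  have hInt : Integrable (fun v : H3 => Torus.inertialPairing (v : L2) w) μ := by
    refine Integrable.mono' (hint.const_mul C) hcont.aestronglyMeasurable (ae_of_all _ fun v => ?_)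
    rw [Real.norm_eq_abs, Submodule.coe_norm]
    exact hC (v : L2)
  have hI1 : ∫ v, Torus.nsGeneratorPairing 0 f v w ∂μ =
      (∫ x, ⟪f x, w x⟫_ℝ) + ∫ v, Torus.inertialPairing (v : L2) w ∂μ := by
    simp_rw [hgen]
    rw [integral_add (integrable_const _) hInt, integral_const]
    simp
  -- (3) integrate the form bound (valid `μ`-a.e.: finite enstrophy a.e.)
  have hae : ∀ᵐ v : H3 ∂μ,
      -(sE * ‖v‖ ^ 2 + sG * (Torus.eGradNormSq ((v : L2) : Vec3)).toReal) ≤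
        Torus.inertialPairing (v : L2) w := by
    filter_upwards [hGlt] with v hv
    exact hform v hv.ne
  have hLint : Integrable (fun v : H3 =>
      -(sE * ‖v‖ ^ 2 + sG * (Torus.eGradNormSq ((v : L2) : Vec3)).toReal)) μ :=
    ((hint.const_mul sE).add (haI.const_mul sG)).neg
  have hmono := integral_mono_ae hLint hInt hae
  rw [integral_neg, integral_add (hint.const_mul sE) (haI.const_mul sG), integral_const_mul,
    integral_const_mul, hGa] at hmono
  unfold Torus.ensembleEnergy
  linarith

/-! ## The stub -/

/-- **Stub `stub_linearFloor`** — THE LINEAR LAYER. A smooth solenoidal mean-zero field `w` with the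
form bound `−(s_E |v|² + s_G ‖∇v‖²) ≤ ∫ (v ⊗ v) : ∇w` on finite-enstrophy fields of `H` certifies
the tame floor of `f_GP` at every level `(E, G₁)` with `s_E E + s_G max(G₁, 0) < (f_GP, w)`:
removing the cut-off (`stub_linearTestLimit`) a Φ-uniform defect `≤ r` gives
`|∫ ⟨f_GP − B(v,v), w⟩ dμ| ≤ r ‖∇w‖₂`, while integrating the form bound gives
`∫ ⟨f_GP − B(v,v), w⟩ dμ ≥ (f_GP, w) − s_E E − s_G max(G₁,0) > 0`; take
`r = gap / (2(‖∇w‖₂ + 1))`. [folklore] -/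
theorem stub_linearFloor : ∀ (f w : Vec3), f = gpForce → Torus.IsSmooth w → Torus.IsDivFree w → Torus.HasZeroMean w → ∀ (sE sG : ℝ), 0 ≤ sE → 0 ≤ sG → (∀ v : H3, Torus.eGradNormSq ((v : L2) : Vec3) ≠ ⊤ → -(sE * ‖v‖ ^ 2 + sG * (Torus.eGradNormSq ((v : L2) : Vec3)).toReal) ≤ Torus.inertialPairing (v : L2) w) → ∀ (E G₁ : ℝ), sE * E + sG * max G₁ 0 < ∫ x, ⟪f x, w x⟫_ℝ → ∃ r : ℝ, 0 < r ∧ ∀ μ : Measure H3, IsProbabilityMeasure μ → Integrable (fun v : H3 => ‖v‖ ^ 2) μ → Torus.ensembleEnergy μ ≤ E → Torus.ensembleEnstrophy μ ≤ ENNReal.ofReal G₁ → ¬ (∀ Φ : Torus.CylindricalTest (Fin 3), Integrable (fun v : H3 => Torus.nsGeneratorPairing 0 f v (Φ.grad v)) μ ∧ |∫ v, Torus.nsGeneratorPairing 0 f v (Φ.grad v) ∂μ| ≤ r * Real.sqrt (∫ v, Torus.gradNormSq (Φ.grad v) ∂μ)) := by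
  intro f w hf hw hdw hzw sE sG hsE hsG hform E G₁ hlev
  -- the data: `P = (f, w)`, `M = max(G₁, 0)`, `Q = ‖∇w‖₂`, `r = (P − s_E E − s_G M)/(2(Q+1))`
  set P : ℝ := ∫ x, ⟪f x, w x⟫_ℝ with hP
  set M : ℝ := max G₁ 0 with hM
  set Q : ℝ := Real.sqrt (Torus.gradNormSq w) with hQ
  have hQ0 : 0 ≤ Q := Real.sqrt_nonneg _
  have hgap : 0 < P - sE * E - sG * M := by linarith
  refine ⟨(P - sE * E - sG * M) / (2 * (Q + 1)), by positivity, ?_⟩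
  intro μ hμ hint hEn hG hdef
  haveI := hμ
  have hf2 : MemLp f 2 volume := by
    rw [hf]
    exact GPStatisticalRigidity.gpForce_isSmooth.memLp 2
  -- (1) removing the cut-off: the balance against the fixed field `w`
  obtain ⟨-, hbal⟩ :=
    GPStatisticalRigidity.stub_linearTestLimit f w hf2 hw hdw hzw μ hμ hint _ hdef
  -- (2) the lower bound `∫ ⟨f − B(v,v), w⟩ dμ ≥ P − s_E e(μ) − s_G G(μ)`
  have hGfin : Torus.ensembleEnstrophy μ < ⊤ := hG.trans_lt ENNReal.ofReal_lt_top
  have hlow := linFloor_integral_nsGeneratorPairing_ge f hw hform μ hint hGfin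
  -- (3) monotonicity in the levels
  have hE' : sE * Torus.ensembleEnergy μ ≤ sE * E := mul_le_mul_of_nonneg_left hEn hsE
  have hGM : (Torus.ensembleEnstrophy μ).toReal ≤ M := by
    have h := ENNReal.toReal_mono ENNReal.ofReal_ne_top hG
    rwa [ENNReal.toReal_ofReal'] at h
  have hG' : sG * (Torus.ensembleEnstrophy μ).toReal ≤ sG * M := mul_le_mul_of_nonneg_left hGM hsG
  have habs := le_abs_self (∫ v, Torus.nsGeneratorPairing 0 f v w ∂μ)
  -- (4) `gap ≤ r Q < gap`
  have h1 : P - sE * E - sG * M ≤ (P - sE * E - sG * M) / (2 * (Q + 1)) * Q := by linarith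
  have h3 : (P - sE * E - sG * M) / (2 * (Q + 1)) * Q < P - sE * E - sG * M := by
    rw [div_mul_eq_mul_div, div_lt_iff₀ (by positivity)]
    nlinarith
  linarith

end Summit.AnomalousDissipation.AnomalousDissipation.Theorems.EnsembleRigidity.GPTameDefectFloor

end
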